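import Summits.CriticalPhenomena.Ising3DConformalLimit.Theorems.IsingEuclidUpgradeR4NonGaussianDefs
import Literature.Probability.LatticeModels.PointwiseScalingLimitEtaExists
import Literature.Probability.LatticeModels.HighDimPointwiseTriviality
import Literature.Probability.LatticeModels.CriticalCorrWellDefined
import Literature.Probability.LatticeModels.SharpnessSubcritical
import HarnessLib

/-!
# Crux `WindowForcesU4` (stmt-CriticalPhenomena-5505), line `backbone-thinning-window` (reshape r1):
# stub `stub_backboneMomentComparison` — moment comparison on the counting region `Λ_L + 2Le₁`

`G = criticalTwoPoint 3`. From the window `c_W (n/m)^{-(3/2-ε)} G(me₁) ≤ G(ne₁)`, the room `θ < ε` and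
the θ-bubble `Σ_{0≠w∈Λ_R} ‖w‖^{-2θ}G(w)² ≤ C_b R^{3-2θ} G(Re₁)²`, for the sources `0, 4Le₁, 2Le₁ ± 3Le₂`
and densities `fᵢ ≥ cL^{-θ}·(three-point ratio)`, `0 ≤ gᵢ(u,u) ≤ fᵢ(u)`,
`0 ≤ gᵢ(u,v) ≤ CL^{-θ}‖u-v‖^{-θ}·(two-step/G)` on `A = Λ_L + 2Le₁`: `c₀ ΣΣ g₁g₂ ≤ (Σ f₁f₂)² > 0`
eventually in `L`, `n`. Ingredients: box two-point functions within a factor `2` of `G` on `Λ_{4L}`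
(eventually in `n`); sup-norm geometry (distances in `[L, 6L]`, differences in `Λ_{2L}`, `|A| ≥ L³`);
the pair window `ℓG(Le₁) ≤ G(x) ≤ G(Le₁)`, `L ≤ ‖x‖_∞ ≤ 6L`, `ℓ = c_W 18^{-(3/2-ε)}` (MMS + WINDOW);
hence `Σf₁f₂ ≥ |A|(kL^{-θ}G(Le₁))² ≥ (kc_WG(e₁))²L^{2(ε-θ)}` and the off-diagonal sum is
`≤ K|A|L^{3-4θ}G(Le₁)⁴ ≤ (K/k⁴)(Σf₁f₂)²` (θ-bubble at `R = 2L`, `G(2Le₁) ≤ G(Le₁)`). Box-limit and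
pair-window lemmas adapted from `Theorems/LatticeSDPCertificatesWindowForcesU4WindowLatticeMomentRatio`.
References: M. Aizenman, H. Duminil-Copin, Ann. Math. 194 (2021) = arXiv:1912.07973, §4.2 Lemma 4.4;
A. Messager, S. Miracle-Solé, J. Stat. Phys. 17 (1977).
-/

noncomputable section

open Filter Topology Set Function MeasureTheory Finset
open Literature.Probability.LatticeModels Literature.Probability.Percolation
open Summit.CriticalPhenomena.Ising3DConformalLimit.Cruxes.IsingEuclidUpgradeR4NonGaussian.FreeCovarianceDeltaDichotomy
  (boxG threePointRatio twoStep)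

namespace Summit.CriticalPhenomena.Ising3DConformalLimit.LatticeSDPCertificatesWindowForcesU4.BackboneMomentComparisonProof

/-- `0 < ⟨σ₀σ_w⟩_{β_c}` on `ℤ³` (Simon–Lieb power lower bound off the origin, `= 1` at it). [folklore] -/
private theorem criticalTwoPoint_pos (w : Site 3) : 0 < criticalTwoPoint 3 w := by
  -- adapted from LatticeSDPCertificatesWindowForcesU4WindowLatticeMomentRatio (criticalCorr_pair_pos)
  by_cases hw : w = 0
  · rw [hw, criticalTwoPoint_zero']; exact one_pos
  · obtain ⟨c, C, hc, h⟩ := criticalTwoPoint_bounds_holds (d := 3) le_rfl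
    exact lt_of_lt_of_le (mul_pos hc (Real.rpow_pos_of_pos (norm_pos_iff.2 hw) _)) (h _ hw).1

/-- The free box two-point function converges to the critical two-point function. [folklore] -/
private theorem tendsto_boxG (u v : Site 3) :
    Tendsto (fun n => boxG n u v) atTop (𝓝 (criticalTwoPoint 3 (v - u))) := by
  -- adapted from LatticeSDPCertificatesWindowForcesU4WindowLatticeMomentRatio (tendsto_boxG)
  have h := criticalCorr_wellDefined_holds (d := 3) le_rfl 2 ![u, v] .free (by simp)
  rw [criticalCorr_two_pair] at h
  exact Tendsto.congr (fun L => by simp only [boxG, isingTwoPoint, spinMonomial_two]) h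

/-- Eventually in `n`, the free box two-point functions on `Λ_M` are within a factor `2` of `G > 0`.
[folklore] -/
private theorem eventually_boxG_near (M : ℕ) : ∀ᶠ n : ℕ in atTop, ∀ x ∈ box 3 M, ∀ y ∈ box 3 M,
    criticalTwoPoint 3 (y - x) / 2 < boxG n x y ∧ boxG n x y < 2 * criticalTwoPoint 3 (y - x) := by
  refine (Filter.eventually_all_finset _).2 fun x _ => (Filter.eventually_all_finset _).2 fun y _ =>
    ((tendsto_boxG x y).eventually_const_lt (half_lt_self (criticalTwoPoint_pos _))).and
      ((tendsto_boxG x y).eventually_lt_const (by linarith [criticalTwoPoint_pos (y - x)]))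

/-- `xy ≤ κ²R²` from `0 ≤ x ≤ κQ₁`, `0 ≤ y ≤ κQ₂`, `0 ≤ Qᵢ ≤ R`. [folklore] -/
private theorem offdiag_term {x y κ Q₁ Q₂ R : ℝ} (hx0 : 0 ≤ x) (hx : x ≤ κ * Q₁)
    (hy0 : 0 ≤ y) (hy : y ≤ κ * Q₂) (hQ₁ : 0 ≤ Q₁) (hQ₁R : Q₁ ≤ R) (hQ₂ : 0 ≤ Q₂) (hQ₂R : Q₂ ≤ R) :
    x * y ≤ κ ^ 2 * R ^ 2 := by
  nlinarith [mul_le_mul hx hy hy0 (hx0.trans hx),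
    mul_le_mul_of_nonneg_left (mul_le_mul hQ₁R hQ₂R hQ₂ (hQ₁.trans hQ₁R)) (sq_nonneg κ)]

/-- `(x^{-θ})² = x^{-2θ}` for `x ≥ 0`. [folklore] -/
private theorem rpow_neg_sq {x θ : ℝ} (hx : 0 ≤ x) : (x ^ (-θ)) ^ 2 = x ^ (-(2 * θ)) := by
  rw [show -(2 * θ) = -θ * ((2 : ℕ) : ℝ) by rw [Nat.cast_ofNat]; ring, Real.rpow_mul_natCast hx]

/-- `L^{3-2θ} = L³ (L^{-θ})²` for `L > 0`. [folklore] -/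
private theorem rpow_three_sub {L θ : ℝ} (hL : 0 < L) : L ^ ((3:ℝ) - 2 * θ) = L ^ 3 * (L ^ (-θ)) ^ 2 := by
  rw [rpow_neg_sq hL.le, ← Real.rpow_natCast L 3, ← Real.rpow_add hL, Nat.cast_ofNat, sub_eq_add_neg]

/-- The room `θ < ε`: `L³ (L^{-θ})² (L^{-(3/2-ε)})² = L^{2(ε-θ)} ≥ 1` for `L ≥ 1`. [folklore] -/
private theorem one_le_scale {L θ ε : ℝ} (hL : 1 ≤ L) (hθε : θ < ε) :
    1 ≤ L ^ 3 * (L ^ (-θ)) ^ 2 * (L ^ (-((3:ℝ) / 2 - ε))) ^ 2 := by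
  have hL0 : 0 < L := one_pos.trans_le hL
  rw [← Real.rpow_natCast L 3, ← Real.rpow_mul_natCast hL0.le, ← Real.rpow_mul_natCast hL0.le,
    ← Real.rpow_add hL0, ← Real.rpow_add hL0]
  exact Real.one_le_rpow hL (by push_cast; linarith)

/-- Final bookkeeping: `E ≥ N(ktg)²`, `N ≥ L³`, `L³t²r² ≥ 1`, `mr ≤ g` give `E ≥ (km)² > 0`; with
`S ≤ E + O`, `O ≤ K·NL³t⁴g⁴ ≤ (K/k⁴)E²` this gives `c₀ S ≤ E²`, `c₀ = 1/((km)⁻² + K/k⁴)`. [folklore] -/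
private theorem final_algebra {k K m N L3 t r g E S O : ℝ} (hk : 0 < k) (hK : 0 ≤ K) (hm : 0 < m)
    (ht : 0 < t) (hr : 0 < r) (hg : 0 < g) (hL3 : 0 ≤ L3) (hN : L3 ≤ N)
    (hscale : 1 ≤ L3 * t ^ 2 * r ^ 2) (hwin : m * r ≤ g) (hE : N * (k * t * g) ^ 2 ≤ E) (hS : S ≤ E + O)
    (hO : O ≤ K * (N * L3 * t ^ 4 * g ^ 4)) : 1 / (1 / (k * m) ^ 2 + K / k ^ 4) * S ≤ E ^ 2 ∧ 0 < E := by
  have hN0 : 0 ≤ N := hL3.trans hN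
  have h1 : (k * m) ^ 2 ≤ E := by
    calc (k * m) ^ 2 ≤ (k * m) ^ 2 * (L3 * t ^ 2 * r ^ 2) := le_mul_of_one_le_right (sq_nonneg _) hscale
      _ = L3 * (k * t * (m * r)) ^ 2 := by ring
      _ ≤ N * (k * t * g) ^ 2 := mul_le_mul hN (pow_le_pow_left₀ (by positivity)
          (mul_le_mul_of_nonneg_left hwin (by positivity)) 2) (sq_nonneg _) hN0
      _ ≤ E := hE
  have hEpos : 0 < E := lt_of_lt_of_le (by positivity) h1
  refine ⟨?_, hEpos⟩
  have hX : k ^ 4 * (N * L3 * t ^ 4 * g ^ 4) ≤ E ^ 2 := by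
    nlinarith [mul_le_mul hE hE (by positivity) (hEpos.le), hN0,
      mul_le_mul_of_nonneg_right hN (by positivity : (0:ℝ) ≤ N * (k * t * g) ^ 4)]
  have h2 : O ≤ K / k ^ 4 * E ^ 2 := hO.trans <| by
    rw [show K * (N * L3 * t ^ 4 * g ^ 4) = K / k ^ 4 * (k ^ 4 * (N * L3 * t ^ 4 * g ^ 4)) by field_simp]
    exact mul_le_mul_of_nonneg_left hX (by positivity)
  have h3 : E ≤ 1 / (k * m) ^ 2 * E ^ 2 := by
    rw [one_div, le_inv_mul_iff₀ (by positivity : (0:ℝ) < (k * m) ^ 2)]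
    exact (mul_le_mul_of_nonneg_right h1 hEpos.le).trans_eq (pow_two E).symm
  have hpos : 0 < 1 / (k * m) ^ 2 + K / k ^ 4 := by positivity
  refine (mul_le_mul_of_nonneg_left (hS.trans (add_le_add h3 h2)) (by positivity)).trans_eq ?_
  rw [← add_mul, ← mul_assoc, one_div_mul_cancel hpos.ne', one_mul]

/-- A double sum with diagonal `≤ F` and off-diagonal `≤ M·W`, row sums of `W` `≤ B`. [folklore] -/
private theorem double_sum_le {ι : Type*} [DecidableEq ι] (A : Finset ι) (F : ι → ℝ)
    (Gd W : ι → ι → ℝ) {M B : ℝ} (hM : 0 ≤ M) (hdiag : ∀ u ∈ A, Gd u u ≤ F u)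
    (hoff : ∀ u ∈ A, ∀ v ∈ A, u ≠ v → Gd u v ≤ M * W u v) (hW : ∀ u ∈ A, ∑ v ∈ A.erase u, W u v ≤ B) :
    ∑ u ∈ A, ∑ v ∈ A, Gd u v ≤ ∑ u ∈ A, F u + #A * (M * B) := by
  rw [← nsmul_eq_mul, ← Finset.sum_const, ← Finset.sum_add_distrib]
  refine Finset.sum_le_sum fun u hu => ?_
  rw [← Finset.add_sum_erase A _ hu]
  refine add_le_add (hdiag u hu) ?_
  calc ∑ v ∈ A.erase u, Gd u v ≤ ∑ v ∈ A.erase u, M * W u v := Finset.sum_le_sum fun v hv =>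
        hoff u hu v (Finset.mem_of_mem_erase hv) (Finset.ne_of_mem_erase hv).symm
    _ = M * ∑ v ∈ A.erase u, W u v := (Finset.mul_sum _ _ _).symm
    _ ≤ M * B := mul_le_mul_of_nonneg_left (hW u hu) hM

/-- The dilated canonical sources `L·(0, 4e₁, 2e₁+3e₂, 2e₁-3e₂)` in coordinates. [folklore] -/
private theorem Y_smul (L : ℕ) : (L : ℤ) • (0 : Site 3) = ![0, 0, 0] ∧
    (L : ℤ) • ((4 : ℤ) • Pi.single 0 1 : Site 3) = ![4 * (L : ℤ), 0, 0] ∧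
    (L : ℤ) • ((2 : ℤ) • Pi.single 0 1 + (3 : ℤ) • Pi.single 1 1 : Site 3) = ![2 * (L : ℤ), 3 * L, 0] ∧
    (L : ℤ) • ((2 : ℤ) • Pi.single 0 1 - (3 : ℤ) • Pi.single 1 1 : Site 3) = ![2 * (L : ℤ), -(3 * L), 0] := by
  refine ⟨?_, ?_, ?_, ?_⟩ <;> funext j <;> fin_cases j <;> simp <;> ring

/-- Sup-norm geometry: the sources lie in `Λ_{4L}`, the two source pairs are at sup distance `4L`, `6L`,
and for `u ∈ Λ_L + 2Le₁` all four differences `u - Lyᵢ` have sup norm in `[L, 6L]`. [folklore] -/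
private theorem geom {L : ℕ} {a b a' b' u : Site 3} (ha : a = ![0, 0, 0])
    (hb : b = ![4 * (L : ℤ), 0, 0]) (ha' : a' = ![2 * (L : ℤ), 3 * L, 0])
    (hb' : b' = ![2 * (L : ℤ), -(3 * L), 0]) (hu : u - (2 * (L : ℤ)) • (Pi.single 0 1 : Site 3) ∈ box 3 L) :
    (a ∈ box 3 (4 * L) ∧ b ∈ box 3 (4 * L) ∧ a' ∈ box 3 (4 * L) ∧ b' ∈ box 3 (4 * L)) ∧
    ((L ≤ Site.supNorm (b - a) ∧ Site.supNorm (b - a) ≤ 6 * L) ∧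
      (L ≤ Site.supNorm (b' - a') ∧ Site.supNorm (b' - a') ≤ 6 * L)) ∧
    (L ≤ Site.supNorm (u - a) ∧ Site.supNorm (u - a) ≤ 6 * L) ∧
    (L ≤ Site.supNorm (u - b) ∧ Site.supNorm (u - b) ≤ 6 * L) ∧
    (L ≤ Site.supNorm (u - a') ∧ Site.supNorm (u - a') ≤ 6 * L) ∧
    (L ≤ Site.supNorm (u - b') ∧ Site.supNorm (u - b') ≤ 6 * L) := by
  -- adapted from the skeleton's `region_geometry` / `source_geometry` (real norms ↦ integer sup norms)
  subst ha hb ha' hb'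
  rw [mem_box] at hu
  have hu0 := hu 0; have hu1 := hu 1; have hu2 := hu 2
  simp only [Pi.sub_apply, Pi.smul_apply, Pi.single_apply, smul_eq_mul] at hu0 hu1 hu2
  norm_num at hu0 hu1 hu2
  refine ⟨⟨mem_box.2 fun j => ?_, mem_box.2 fun j => ?_, mem_box.2 fun j => ?_, mem_box.2 fun j => ?_⟩,
    ⟨⟨le_trans ?_ (Site.natAbs_le_supNorm _ 0), Site.supNorm_le_iff.2 fun j => ?_⟩,
      ⟨le_trans ?_ (Site.natAbs_le_supNorm _ 1), Site.supNorm_le_iff.2 fun j => ?_⟩⟩,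
    ⟨le_trans ?_ (Site.natAbs_le_supNorm _ 0), Site.supNorm_le_iff.2 fun j => ?_⟩,
    ⟨le_trans ?_ (Site.natAbs_le_supNorm _ 0), Site.supNorm_le_iff.2 fun j => ?_⟩,
    ⟨le_trans ?_ (Site.natAbs_le_supNorm _ 1), Site.supNorm_le_iff.2 fun j => ?_⟩,
    ⟨le_trans ?_ (Site.natAbs_le_supNorm _ 1), Site.supNorm_le_iff.2 fun j => ?_⟩⟩
  all_goals first | (fin_cases j <;> simp <;> omega) | (simp; omega)

/-- `Λ_L + 2Le₁ ⊆ Λ_{4L}`, and differences of two of its points lie in `Λ_{2L}`. [folklore] -/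
private theorem region_box {L : ℕ} {u v : Site 3}
    (hu : u - (2 * (L : ℤ)) • (Pi.single 0 1 : Site 3) ∈ box 3 L)
    (hv : v - (2 * (L : ℤ)) • (Pi.single 0 1 : Site 3) ∈ box 3 L) :
    u ∈ box 3 (4 * L) ∧ u - v ∈ box 3 (2 * L) := by
  rw [mem_box] at hu hv
  have hu0 := hu 0; have hu1 := hu 1; have hu2 := hu 2; have hv0 := hv 0; have hv1 := hv 1; have hv2 := hv 2
  simp only [Pi.sub_apply, Pi.smul_apply, Pi.single_apply, smul_eq_mul] at hu0 hu1 hu2 hv0 hv1 hv2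
  norm_num at hu0 hu1 hu2 hv0 hv1 hv2
  refine ⟨mem_box.2 fun j => ?_, mem_box.2 fun j => ?_⟩ <;> fin_cases j <;> simp <;> omega

/-- `Λ_L + 2Le₁ ⊆ Λ_{n+1}` once `3L ≤ n`, so the region has at least `#Λ_L = (2L+1)³ ≥ L³` points.
[folklore] -/
private theorem region_card {L n : ℕ} (hn : 3 * L ≤ n) (A : Finset (BoxVertex 3 n))
    (hA : ∀ u : BoxVertex 3 n, ((u : Site 3) - (2 * (L : ℤ)) • (Pi.single 0 1 : Site 3)) ∈ box 3 L →
      u ∈ A) : (L : ℝ) ^ 3 ≤ #A := by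
  have h1 : box 3 L ⊆ A.image (fun u : BoxVertex 3 n =>
      (u : Site 3) - (2 * (L : ℤ)) • (Pi.single 0 1 : Site 3)) := by
    intro w hw
    have hw' : w + (2 * (L : ℤ)) • (Pi.single 0 1 : Site 3) ∈ box 3 (n + 1) := by
      rw [mem_box] at hw ⊢
      intro j; have h := hw j
      simp only [Pi.add_apply, Pi.smul_apply, Pi.single_apply, smul_eq_mul, mul_ite, mul_one, mul_zero]
      split_ifs <;> push_cast <;> omega
    exact Finset.mem_image.2 ⟨⟨_, hw'⟩, hA _ (by simpa using hw), by simp⟩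
  have h2 := card_box 3 L ▸ (Finset.card_le_card h1).trans Finset.card_image_le
  calc (L : ℝ) ^ 3 ≤ ((2 * L + 1 : ℕ) : ℝ) ^ 3 := by gcongr; linarith
    _ ≤ (#A : ℝ) := by exact_mod_cast h2

/-- Injecting `v ↦ u - v` (`v ∈ A ∖ {u}`) into `Λ_{2L} ∖ {0}`: the θ-weighted bubble over the region is
at most the θ-bubble at `R = 2L`. [folklore] -/
private theorem region_bubble_le {L n : ℕ} {θ : ℝ} (A : Finset (BoxVertex 3 n))
    (hA : ∀ u ∈ A, ((u : Site 3) - (2 * (L : ℤ)) • (Pi.single 0 1 : Site 3)) ∈ box 3 L)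
    {u : BoxVertex 3 n} (hu : u ∈ A) :
    ∑ v ∈ A.erase u, ‖(u : Site 3) - (v : Site 3)‖ ^ (-(2 * θ)) *
        criticalTwoPoint 3 ((u : Site 3) - (v : Site 3)) ^ 2 ≤
      ∑ w ∈ (box 3 (2 * L)).erase 0, ‖w‖ ^ (-(2 * θ)) * criticalTwoPoint 3 w ^ 2 := by
  rw [← Finset.sum_image (s := A.erase u) (g := fun v : BoxVertex 3 n => (u : Site 3) - (v : Site 3))
    (f := fun w => ‖w‖ ^ (-(2 * θ)) * criticalTwoPoint 3 w ^ 2)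
    (fun v _ v' _ h => Subtype.ext (sub_right_injective h))]
  refine Finset.sum_le_sum_of_subset_of_nonneg (fun w hw => ?_) fun w _ _ =>
    mul_nonneg (Real.rpow_nonneg (norm_nonneg _) _) (sq_nonneg _)
  obtain ⟨v, hv, rfl⟩ := Finset.mem_image.1 hw
  obtain ⟨hvu, hvA⟩ := Finset.mem_erase.1 hv
  exact Finset.mem_erase.2 ⟨fun h => hvu (Subtype.ext (sub_eq_zero.1 h)).symm,
    (region_box (hA u hu) (hA v hvA)).2⟩

/-- WINDOW + the Messager–Miracle-Solé sphere sandwich + axial monotonicity: for `1 ≤ L ≤ ‖w‖_∞ ≤ 6L`,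
`ℓ G(Le₁) ≤ G(w) ≤ G(Le₁)` with `ℓ = c_W 18^{-(3/2-ε)}` (WINDOW between the scales `L` and `18L`).
[cite: MessagerMiracleSoleJSP1977, Theorem (monotonicity)] -/
private theorem window_pair {ε cW : ℝ}
    (hwin : ∀ m n : ℕ, 1 ≤ m → m ≤ n →
      cW * ((n : ℝ) / m) ^ (-((3:ℝ) / 2 - ε)) * criticalTwoPoint 3 (Pi.single 0 (m : ℤ)) ≤
        criticalTwoPoint 3 (Pi.single 0 (n : ℤ)))
    {L : ℕ} (hL : 1 ≤ L) {w : Site 3} (hlo : L ≤ Site.supNorm w) (hhi : Site.supNorm w ≤ 6 * L) :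
    cW * (18:ℝ) ^ (-((3:ℝ) / 2 - ε)) * criticalTwoPoint 3 (Pi.single 0 (L : ℤ)) ≤
        criticalTwoPoint 3 w ∧ criticalTwoPoint 3 w ≤ criticalTwoPoint 3 (Pi.single 0 (L : ℤ)) := by
  -- adapted from LatticeSDPCertificatesWindowForcesU4WindowLatticeMomentRatio (window_pair)
  obtain ⟨hsl, hsu⟩ := criticalTwoPoint_axis_sandwich (hL.trans hlo)
  refine ⟨?_, hsu.trans (criticalTwoPoint_axis_antitone hlo)⟩
  have hW := hwin L (18 * L) hL (by omega)
  have hL0 : (L : ℝ) ≠ 0 := by exact_mod_cast (by omega : L ≠ 0)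
  rw [show ((18 * L : ℕ) : ℝ) / (L : ℝ) = 18 by push_cast; field_simp] at hW
  exact hW.trans ((criticalTwoPoint_axis_antitone (by omega : 3 * Site.supNorm w ≤ 18 * L)).trans hsl)

/-- Per-term estimates for a source pair `(x₁, x₂)` and region points `u, v` (the box two-point functions
involved lie in `[ℓg/2, 2g]`, `g = G(Le₁)`): the three-point ratio `G_n(x₁,u)G_n(u,x₂)/G_n(x₁,x₂)` is
`≥ ℓ²g/8` and the normalised two-step kernel lies in `[0, 32 g G(u-v)/ℓ]`. [folklore] -/
private theorem pair_estimates {ℓ g : ℝ} {L n : ℕ} (hℓ : 0 < ℓ) (hg : 0 < g)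
    (hwp : ∀ w : Site 3, L ≤ Site.supNorm w → Site.supNorm w ≤ 6 * L →
      ℓ * g ≤ criticalTwoPoint 3 w ∧ criticalTwoPoint 3 w ≤ g)
    (hn : ∀ x ∈ box 3 (4 * L), ∀ y ∈ box 3 (4 * L),
      criticalTwoPoint 3 (y - x) / 2 < boxG n x y ∧ boxG n x y < 2 * criticalTwoPoint 3 (y - x))
    {x₁ x₂ u v : Site 3} (hx₁ : x₁ ∈ box 3 (4 * L)) (hx₂ : x₂ ∈ box 3 (4 * L))
    (h12 : L ≤ Site.supNorm (x₂ - x₁) ∧ Site.supNorm (x₂ - x₁) ≤ 6 * L)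
    (hu : u ∈ box 3 (4 * L)) (hv : v ∈ box 3 (4 * L))
    (hu1 : L ≤ Site.supNorm (u - x₁) ∧ Site.supNorm (u - x₁) ≤ 6 * L)
    (hu2 : L ≤ Site.supNorm (u - x₂) ∧ Site.supNorm (u - x₂) ≤ 6 * L)
    (hv1 : L ≤ Site.supNorm (v - x₁) ∧ Site.supNorm (v - x₁) ≤ 6 * L)
    (hv2 : L ≤ Site.supNorm (v - x₂) ∧ Site.supNorm (v - x₂) ≤ 6 * L) :
    ℓ ^ 2 * g / 8 ≤ threePointRatio n x₁ x₂ u ∧ 0 ≤ twoStep n x₁ x₂ u v / boxG n x₁ x₂ ∧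
      twoStep n x₁ x₂ u v / boxG n x₁ x₂ ≤ 32 * g * criticalTwoPoint 3 (u - v) / ℓ := by
  have bd : ∀ {x y : Site 3}, x ∈ box 3 (4 * L) → y ∈ box 3 (4 * L) →
      (L ≤ Site.supNorm (y - x) ∧ Site.supNorm (y - x) ≤ 6 * L) →
      ℓ * g / 2 ≤ boxG n x y ∧ boxG n x y ≤ 2 * g ∧ ℓ * g / 2 ≤ boxG n y x ∧ boxG n y x ≤ 2 * g := by
    intro x y hx hy hxy
    obtain ⟨h1, h2⟩ := hn x hx y hy
    obtain ⟨h3, h4⟩ := hn y hy x hx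
    rw [criticalTwoPoint_sub_comm x y] at h3 h4
    obtain ⟨h5, h6⟩ := hwp (y - x) hxy.1 hxy.2
    refine ⟨?_, ?_, ?_, ?_⟩ <;> linarith
  obtain ⟨pl, pu, -, -⟩ := bd hx₁ hu hu1
  obtain ⟨-, -, q'l, q'u⟩ := bd hx₂ hu hu2
  obtain ⟨p'l, p'u, -, -⟩ := bd hx₁ hv hv1
  obtain ⟨-, -, ql, qu⟩ := bd hx₂ hv hv2
  obtain ⟨sl, su, -, -⟩ := bd hx₁ hx₂ h12
  obtain ⟨ml, mu⟩ := hn u hu v hv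
  obtain ⟨ml', mu'⟩ := hn v hv u hu
  rw [criticalTwoPoint_sub_comm v u] at ml mu
  have h0 : 0 < ℓ * g / 2 := by positivity
  have hG := criticalTwoPoint_nonneg' (d := 3) (u - v)
  have hs0 : 0 < boxG n x₁ x₂ := h0.trans_le sl
  refine ⟨?_, ?_, ?_⟩
  · unfold threePointRatio
    rw [le_div_iff₀ hs0]
    nlinarith [mul_le_mul pl q'l h0.le (h0.le.trans pl),
      mul_le_mul_of_nonneg_left su (by positivity : (0:ℝ) ≤ ℓ ^ 2 * g / 8)]
  · unfold twoStep
    exact div_nonneg (add_nonneg (mul_nonneg (mul_nonneg (h0.le.trans pl) (by linarith)) (h0.le.trans ql))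
      (mul_nonneg (mul_nonneg (h0.le.trans p'l) (by linarith)) (h0.le.trans q'l))) hs0.le
  · unfold twoStep
    rw [div_le_div_iff₀ hs0 hℓ]
    have h1 : boxG n x₁ u * boxG n u v * boxG n v x₂ ≤ 2 * g * (2 * criticalTwoPoint 3 (u - v)) * (2 * g) :=
      mul_le_mul (mul_le_mul pu mu.le (by linarith) (by positivity)) qu (h0.le.trans ql) (by positivity)
    have h2 : boxG n x₁ v * boxG n v u * boxG n u x₂ ≤ 2 * g * (2 * criticalTwoPoint 3 (u - v)) * (2 * g) :=
      mul_le_mul (mul_le_mul p'u mu'.le (by linarith) (by positivity)) q'u (h0.le.trans q'l) (by positivity)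
    nlinarith [mul_le_mul_of_nonneg_right (add_le_add h1 h2) hℓ.le,
      mul_le_mul_of_nonneg_left sl (by positivity : (0:ℝ) ≤ 32 * g * criticalTwoPoint 3 (u - v))]

/-- **Registered stub `stub_backboneMomentComparison`** (moment comparison on the counting region, the
real-analysis heart of Paley–Zygmund at the single-current scale). Under an admissible window `(ε, c_W)`
with room `θ < ε` and the θ-bubble with constant `C_b`, there is `c₀ = c₀(θ,c,C,ε,c_W,C_b) > 0` such
that, eventually in `L` and then in `n`, for the canonical sources and any densities obeying the
one-point floor, the diagonal bounds and the off-diagonal ceiling on `A = Λ_L + 2Le₁`: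
`c₀ ΣΣ_A g₁g₂ ≤ (Σ_A f₁f₂)²` and `Σ_A f₁f₂ > 0`. [cite: AizenmanDuminilCopinAnnals2021, §4.2 Lemma 4.4] -/
theorem stub_backboneMomentComparison :
    ∀ θ c C ε cW Cb : ℝ, 0 ≤ θ → 0 < c → 0 < C → 0 < ε → 0 < cW → θ < ε → 0 < Cb →
      (∀ m n : ℕ, 1 ≤ m → m ≤ n → cW * ((n : ℝ) / m) ^ (-((3:ℝ) / 2 - ε)) * criticalTwoPoint 3 (Pi.single 0 (m : ℤ)) ≤ criticalTwoPoint 3 (Pi.single 0 (n : ℤ))) →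
      (∀ R : ℕ, 1 ≤ R →
        ∑ w ∈ (box 3 R).erase 0, ‖w‖ ^ (-(2 * θ)) * criticalTwoPoint 3 w ^ 2 ≤
          Cb * (R : ℝ) ^ (3 - 2 * θ) * criticalTwoPoint 3 (Pi.single 0 (R : ℤ)) ^ 2) →
      ∃ c₀ : ℝ, 0 < c₀ ∧ ∀ᶠ L : ℕ in atTop, ∀ᶠ n : ℕ in atTop,
        ∀ a b a' b' : BoxVertex 3 n,
          (a : Site 3) = (L : ℤ) • (![0, (4 : ℤ) • Pi.single 0 1, (2 : ℤ) • Pi.single 0 1 + (3 : ℤ) • Pi.single 1 1, (2 : ℤ) • Pi.single 0 1 - (3 : ℤ) • Pi.single 1 1] : Fin 4 → Site 3) 0 →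
          (b : Site 3) = (L : ℤ) • (![0, (4 : ℤ) • Pi.single 0 1, (2 : ℤ) • Pi.single 0 1 + (3 : ℤ) • Pi.single 1 1, (2 : ℤ) • Pi.single 0 1 - (3 : ℤ) • Pi.single 1 1] : Fin 4 → Site 3) 1 →
          (a' : Site 3) = (L : ℤ) • (![0, (4 : ℤ) • Pi.single 0 1, (2 : ℤ) • Pi.single 0 1 + (3 : ℤ) • Pi.single 1 1, (2 : ℤ) • Pi.single 0 1 - (3 : ℤ) • Pi.single 1 1] : Fin 4 → Site 3) 2 →
          (b' : Site 3) = (L : ℤ) • (![0, (4 : ℤ) • Pi.single 0 1, (2 : ℤ) • Pi.single 0 1 + (3 : ℤ) • Pi.single 1 1, (2 : ℤ) • Pi.single 0 1 - (3 : ℤ) • Pi.single 1 1] : Fin 4 → Site 3) 3 →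
          ∀ (f₁ f₂ : BoxVertex 3 n → ℝ) (g₁ g₂ : BoxVertex 3 n → BoxVertex 3 n → ℝ),
            (∀ u : BoxVertex 3 n, ((u : Site 3) - (2 * (L : ℤ)) • (Pi.single 0 1 : Site 3)) ∈ box 3 L →
              c * (L : ℝ) ^ (-θ) * threePointRatio n (a : Site 3) (b : Site 3) (u : Site 3) ≤ f₁ u ∧
              c * (L : ℝ) ^ (-θ) * threePointRatio n (a' : Site 3) (b' : Site 3) (u : Site 3) ≤ f₂ u ∧
              0 ≤ g₁ u u ∧ g₁ u u ≤ f₁ u ∧ 0 ≤ g₂ u u ∧ g₂ u u ≤ f₂ u) →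
            (∀ u v : BoxVertex 3 n, u ≠ v → ((u : Site 3) - (2 * (L : ℤ)) • (Pi.single 0 1 : Site 3)) ∈ box 3 L → ((v : Site 3) - (2 * (L : ℤ)) • (Pi.single 0 1 : Site 3)) ∈ box 3 L →
              0 ≤ g₁ u v ∧
              g₁ u v ≤ C * (L : ℝ) ^ (-θ) * ‖(u : Site 3) - (v : Site 3)‖ ^ (-θ) *
                twoStep n (a : Site 3) (b : Site 3) (u : Site 3) (v : Site 3) / boxG n (a : Site 3) (b : Site 3) ∧
              0 ≤ g₂ u v ∧
              g₂ u v ≤ C * (L : ℝ) ^ (-θ) * ‖(u : Site 3) - (v : Site 3)‖ ^ (-θ) *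
                twoStep n (a' : Site 3) (b' : Site 3) (u : Site 3) (v : Site 3) / boxG n (a' : Site 3) (b' : Site 3)) →
            c₀ * ∑ u ∈ Finset.univ.filter (fun u : BoxVertex 3 n => ((u : Site 3) - (2 * (L : ℤ)) • (Pi.single 0 1 : Site 3)) ∈ box 3 L),
                ∑ v ∈ Finset.univ.filter (fun u : BoxVertex 3 n => ((u : Site 3) - (2 * (L : ℤ)) • (Pi.single 0 1 : Site 3)) ∈ box 3 L), g₁ u v * g₂ u v ≤
              (∑ u ∈ Finset.univ.filter (fun u : BoxVertex 3 n => ((u : Site 3) - (2 * (L : ℤ)) • (Pi.single 0 1 : Site 3)) ∈ box 3 L), f₁ u * f₂ u) ^ 2 ∧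
            0 < ∑ u ∈ Finset.univ.filter (fun u : BoxVertex 3 n => ((u : Site 3) - (2 * (L : ℤ)) • (Pi.single 0 1 : Site 3)) ∈ box 3 L), f₁ u * f₂ u := by
  intro θ c C ε cW Cb _ hc hC _ hcW hθε hCb hW hB
  -- ① constants `ℓ` (pair window), `k`, `K` and `c₀ = 1/((k c_W G(e₁))⁻² + K/k⁴)`; then eventually in
  -- `L ≥ 1` and in `n` (factor-two box approximations on `Λ_{4L}`, `3L ≤ n`)
  have hℓ : 0 < cW * (18:ℝ) ^ (-((3:ℝ) / 2 - ε)) := mul_pos hcW (Real.rpow_pos_of_pos (by norm_num) _)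
  set ℓ : ℝ := cW * (18:ℝ) ^ (-((3:ℝ) / 2 - ε)) with hℓdef
  have hG₁ : 0 < criticalTwoPoint 3 (Pi.single 0 1) := criticalTwoPoint_pos _
  set k : ℝ := c * ℓ ^ 2 / 8 with hkdef
  set K : ℝ := 1024 * C ^ 2 * Cb * (2:ℝ) ^ ((3:ℝ) - 2 * θ) / ℓ ^ 2 with hKdef
  obtain ⟨hk, hK⟩ : 0 < k ∧ 0 < K := ⟨by positivity, by positivity⟩
  refine ⟨1 / (1 / (k * (cW * criticalTwoPoint 3 (Pi.single 0 1))) ^ 2 + K / k ^ 4), by positivity, ?_⟩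
  filter_upwards [eventually_ge_atTop 1] with L hL
  filter_upwards [eventually_boxG_near (4 * L), eventually_ge_atTop (3 * L)] with n hn hn3
  intro a b a' b' ha hb ha' hb' f₁ f₂ g₁ g₂ hone htwo
  set A := Finset.univ.filter (fun u : BoxVertex 3 n =>
    ((u : Site 3) - (2 * (L : ℤ)) • (Pi.single 0 1 : Site 3)) ∈ box 3 L) with hA
  have hmemA : ∀ {u : BoxVertex 3 n},
      u ∈ A ↔ ((u : Site 3) - (2 * (L : ℤ)) • (Pi.single 0 1 : Site 3)) ∈ box 3 L := by simp [hA]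
  -- ② `g = G(Le₁)`, `t = L^{-θ}`, the pair window at scale `L`, the sources in coordinates
  have hL0 : (0:ℝ) < L := by exact_mod_cast hL
  have hg : 0 < criticalTwoPoint 3 (Pi.single 0 (L : ℤ)) := criticalTwoPoint_axis_pos L
  set g : ℝ := criticalTwoPoint 3 (Pi.single 0 (L : ℤ)) with hgdef
  set t : ℝ := (L : ℝ) ^ (-θ) with htdef
  have hwp : ∀ w : Site 3, L ≤ Site.supNorm w → Site.supNorm w ≤ 6 * L →
      ℓ * g ≤ criticalTwoPoint 3 w ∧ criticalTwoPoint 3 w ≤ g := fun w h1 h2 => window_pair hW hL h1 h2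
  obtain ⟨e0, e1, e2, e3⟩ := Y_smul L
  simp only [Matrix.cons_val, e0, e1, e2, e3] at ha hb ha' hb'
  -- ③ the one-point floor `f₁f₂ ≥ (ktg)²` and the off-diagonal ceiling on `A`
  have hF : ∀ u ∈ A, (k * t * g) ^ 2 ≤ f₁ u * f₂ u := by
    intro u hu
    obtain ⟨h1, h2, -⟩ := hone u (hmemA.1 hu)
    obtain ⟨⟨ha4, hb4, ha4', hb4'⟩, ⟨hab, hab'⟩, hua, hub, hua', hub'⟩ := geom ha hb ha' hb' (hmemA.1 hu)
    have hu4 := (region_box (hmemA.1 hu) (hmemA.1 hu)).1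
    have l1 := (pair_estimates hℓ hg hwp hn ha4 hb4 hab hu4 hu4 hua hub hua hub).1
    have l2 := (pair_estimates hℓ hg hwp hn ha4' hb4' hab' hu4 hu4 hua' hub' hua' hub').1
    have hct : 0 ≤ c * t := by positivity
    have f1 := (mul_le_mul_of_nonneg_left l1 hct).trans h1
    rw [show k * t * g = c * t * (ℓ ^ 2 * g / 8) by rw [hkdef]; ring, pow_two]
    exact mul_le_mul f1 ((mul_le_mul_of_nonneg_left l2 hct).trans h2) (by positivity)
      ((by positivity : (0:ℝ) ≤ c * t * (ℓ ^ 2 * g / 8)).trans f1)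
  have hoff : ∀ u ∈ A, ∀ v ∈ A, u ≠ v → g₁ u v * g₂ u v ≤
      (C * t) ^ 2 * (32 * g / ℓ) ^ 2 * (‖(u : Site 3) - (v : Site 3)‖ ^ (-(2 * θ)) *
        criticalTwoPoint 3 ((u : Site 3) - (v : Site 3)) ^ 2) := by
    intro u hu v hv huv
    have hu' := hmemA.1 hu; have hv' := hmemA.1 hv
    obtain ⟨h1, h2, h3, h4⟩ := htwo u v huv hu' hv'
    rw [mul_div_assoc] at h2 h4
    obtain ⟨⟨ha4, hb4, ha4', hb4'⟩, ⟨hab, hab'⟩, hua, hub, hua', hub'⟩ := geom ha hb ha' hb' hu'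
    obtain ⟨-, -, hva, hvb, hva', hvb'⟩ := geom ha hb ha' hb' hv'
    have hu4 := (region_box hu' hv').1; have hv4 := (region_box hv' hu').1
    obtain ⟨-, q1, q1'⟩ := pair_estimates hℓ hg hwp hn ha4 hb4 hab hu4 hv4 hua hub hva hvb
    obtain ⟨-, q2, q2'⟩ := pair_estimates hℓ hg hwp hn ha4' hb4' hab' hu4 hv4 hua' hub' hva' hvb'
    refine (offdiag_term h1 h2 h3 h4 q1 q1' q2 q2').trans_eq ?_
    rw [← rpow_neg_sq (norm_nonneg _)]
    ring
  -- ④ the sums: `E ≥ |A|(ktg)²`, `ΣΣ ≤ E + |A|·M·(θ-bubble at 2L)` (diagonal `≤ f₁f₂`), `|A| ≥ L³`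
  have hE : (#A : ℝ) * (k * t * g) ^ 2 ≤ ∑ u ∈ A, f₁ u * f₂ u := by
    simpa only [nsmul_eq_mul] using Finset.card_nsmul_le_sum A (fun u => f₁ u * f₂ u) _ hF
  have hS := double_sum_le A (fun u => f₁ u * f₂ u) (fun u v => g₁ u v * g₂ u v)
    (fun u v : BoxVertex 3 n => ‖(u : Site 3) - (v : Site 3)‖ ^ (-(2 * θ)) *
      criticalTwoPoint 3 ((u : Site 3) - (v : Site 3)) ^ 2)
    (by positivity : (0:ℝ) ≤ (C * t) ^ 2 * (32 * g / ℓ) ^ 2)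
    (fun u hu => by
      obtain ⟨-, -, h1, h2, h3, h4⟩ := hone u (hmemA.1 hu)
      exact mul_le_mul h2 h4 h3 (h1.trans h2))
    hoff (fun u hu => (region_bubble_le A (fun v hv => hmemA.1 hv) hu).trans (hB (2 * L) (by omega)))
  have hN : (L : ℝ) ^ 3 ≤ #A := region_card hn3 A fun u hu => hmemA.2 hu
  -- ⑤ `final_algebra`, with WINDOW at `m = 1` and the θ-bubble at `R = 2L` (`(2L)^{3-2θ} = 2^{3-2θ}L³t²`)
  refine final_algebra hk hK.le (by positivity) (Real.rpow_pos_of_pos hL0 _) (Real.rpow_pos_of_pos hL0 _)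
    hg (by positivity) hN (one_le_scale (by exact_mod_cast hL) hθε) ?_ hE hS ?_
  · have h := hW 1 L le_rfl hL
    simp only [Nat.cast_one, div_one] at h
    calc _ = cW * (L : ℝ) ^ (-((3:ℝ) / 2 - ε)) * criticalTwoPoint 3 (Pi.single 0 1) := by ring
      _ ≤ g := h
  · have h2g : criticalTwoPoint 3 (Pi.single 0 ((2 * L : ℕ) : ℤ)) ^ 2 ≤ g ^ 2 :=
      pow_le_pow_left₀ (criticalTwoPoint_nonneg' _)
        (criticalTwoPoint_axis_antitone (by omega : L ≤ 2 * L)) 2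
    have hR : ((2 * L : ℕ) : ℝ) ^ ((3:ℝ) - 2 * θ) = (2:ℝ) ^ ((3:ℝ) - 2 * θ) * ((L : ℝ) ^ 3 * t ^ 2) := by
      rw [Nat.cast_mul, Nat.cast_ofNat, Real.mul_rpow two_pos.le hL0.le, rpow_three_sub hL0, htdef]
    calc _ ≤ (#A : ℝ) * ((C * t) ^ 2 * (32 * g / ℓ) ^ 2 * (Cb * ((2 * L : ℕ) : ℝ) ^ (3 - 2 * θ) *
          g ^ 2)) := by gcongr
      _ = _ := by rw [hR, hKdef]; field_simp; ring

end Summit.CriticalPhenomena.Ising3DConformalLimit.LatticeSDPCertificatesWindowForcesU4.BackboneMomentComparisonProof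

end
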